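import Literature.NumberTheory.Sieve.DrappeauDispersionMainTerms
import Literature.NumberTheory.Sieve.DrappeauDispersionMainTermsSwap
import Literature.NumberTheory.Sieve.DrappeauDispersionKernelExpansion
import HarnessLib

/-!
# Drappeau 2017, §5.6: the bound `X₁ − X₃ ≪ (log x)^{O(1)} (N + N²R⁻²)` — proved

S. Drappeau, *Sums of Kloosterman sums in arithmetic progressions, and the error term in the
dispersion method*, Proc. London Math. Soc. (3) 114 (2017) 684–732 = arXiv:1504.05549
(`Drappeau2017`; held as `paper:arxiv-1504.05549`, §5.6 read on chunk 21).

§5.6 of the source ("The main terms"): "The main terms `X₁` and `X₃` … combine to form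
`X₁ − X₃ = ∑_{(q₁q₂,a₁a₂)=1} γ(q₁)γ(q₂)/[q₁,q₂] ∑_{n₁,n₂,(nⱼ,qⱼa₂)=1} β̄_{n₁}β_{n₂} 𝔲_R(n₁n̄₂;(q₁,q₂))`
(5.21) … we have the desired bound `X₁ − X₃ ≪ N²R⁻²(log x)^{O(1)}` [`+ N (log x)^{O(1)}`]."
For the right side of (5.21) (`mainTermsDiff`, file `…DrappeauDispersionMainTerms`, where
`X₁ − X₃ = mainTermsDiff` is proved) with a weight `|γ| ≤ 1` on a finite set of moduli
`𝒬 ⊆ [1, L]` and coefficients `β` on `𝒩 ⊆ (M₀, M₀ + N]`, this file PROVES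

`|X₁ − X₃| ≤ (1 + log L)⁴ (2(N+1)/R² + 6 + 4 log L) ∑_{n ∈ 𝒩} |β_n|²`  (`norm_mainTermsDiff_le`),

which is the printed `≪ (log x)^{O(1)}(N + N²R⁻²)` once `∑|β_n|² ≪ N(log x)^{O(1)}` (`|β_n| ≤ τ(n)^A`).

Proof (a variant of the printed one that avoids the Möbius inversion in `dⱼ`): expand
`𝔲_R(n̄₂n₁; g)`, `g = (q₁,q₂)`, over the primitive characters `ψ mod f`, `f ∣ g`, `f > R`
(`norm_sum_sum_mul_uR_le`), bound `|γγ|/([q₁,q₂]φ(g)) ≤ (1+log L)²/(q₁q₂)`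
(`inv_lcm_mul_totient_gcd_le`), `|B₁||B₂| ≤ (|B₁|² + |B₂|²)/2`, exchange the moduli with `(f, ψ)`
(`sum_sum_inv_mul_sum_primIndex_gcd_le`, using that the character sum over `n` coprime to `fk` is
the one over `n` coprime to `k`), and finish with the large sieve over conductors `> R`
(`largeSieve_tail_filter_inv`, `largeSieve_tail_filter_conj`) and `∑_{k ≤ L} 1/k ≤ 1 + log L`.

## References

* S. Drappeau, Proc. London Math. Soc. (3) 114 (2017) 684–732, arXiv:1504.05549, §5.6 (5.21).
  [Drappeau2017]
-/

noncomputable section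

open Finset DirichletCharacter
open scoped Classical

namespace Literature.NumberTheory.Sieve

namespace Drappeau2017

/-- `ℕ`-indexed form of `norm_sum_sum_mul_uR_le`: for finite sets `T₁, T₂` of naturals coprime to
`s ≠ 0` and weights `u, v`,
`‖∑_{n₁ ∈ T₁} ∑_{n₂ ∈ T₂} u(n₁) v(n₂) 𝔲_R(n̄₁ n₂; s)‖
  ≤ φ(s)⁻¹ ∑_{(f,ψ) ∈ primIndex s, f > R} ‖∑ u(n₁) ψ(n₁)⁻¹‖ ‖∑ v(n₂) ψ(n₂)‖`. [cite: Drappeau2017, §5.6] -/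
theorem norm_sum_sum_mul_uR_le_nat (R : ℝ) (s : ℕ) [NeZero s] (T₁ T₂ : Finset ℕ) (u v : ℕ → ℂ)
    (hT₁ : ∀ n ∈ T₁, n.Coprime s) (hT₂ : ∀ n ∈ T₂, n.Coprime s) :
    ‖∑ n₁ ∈ T₁, ∑ n₂ ∈ T₂, u n₁ * v n₂ * uR R s (((n₁ : ZMod s))⁻¹ * (n₂ : ZMod s))‖ ≤
      ((Nat.totient s : ℝ))⁻¹ * ∑ p ∈ (primIndex s).filter (fun p => R < (p.1 : ℝ)),
        ‖∑ n₁ ∈ T₁, u n₁ * (p.2 (n₁ : ZMod p.1))⁻¹‖ * ‖∑ n₂ ∈ T₂, v n₂ * p.2 (n₂ : ZMod p.1)‖ := by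
  have h := norm_sum_sum_mul_uR_le R s (T₁.map Nat.castEmbedding) (T₂.map Nat.castEmbedding)
    (fun z => u z.toNat) (fun z => v z.toNat) ?_ ?_
  · simpa only [Finset.sum_map, Nat.castEmbedding_apply, Int.toNat_natCast, Int.cast_natCast]
      using h
  · intro z hz
    rw [Finset.mem_map] at hz
    obtain ⟨n, hn, rfl⟩ := hz
    exact Nat.isCoprime_iff_coprime.2 (hT₁ n hn)
  · intro z hz
    rw [Finset.mem_map] at hz
    obtain ⟨n, hn, rfl⟩ := hz
    exact Nat.isCoprime_iff_coprime.2 (hT₂ n hn)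

/-- **The main terms of the dispersion** (Drappeau §5.6: "`X₁ − X₃ ≪ (log x)^{O(1)}(N + N²R⁻²)` …
By hypothesis `R ≤ x^δ`, so we have the desired bound"): for `𝒬 ⊆ [1, L]`, `|γ| ≤ 1`,
`𝒩 ⊆ (M₀, M₀ + N]` and `1 ≤ R`,
`|X₁ − X₃| ≤ (1 + log L)⁴ (2(N+1)/R² + 6 + 4 log L) ∑_{n ∈ 𝒩} |β_n|²`.
[cite: Drappeau2017, §5.6] -/
theorem norm_mainTermsDiff_le {R : ℕ} (hR : 1 ≤ R) (a₁ a₂ : ℤ) {𝒬 𝒩 : Finset ℕ} {L M₀ N : ℕ}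
    (h𝒬 : 𝒬 ⊆ Icc 1 L) (h𝒩 : 𝒩 ⊆ Ioc M₀ (M₀ + N)) (γ : ℕ → ℝ) (hγ : ∀ q, |γ q| ≤ 1)
    (β : ℕ → ℂ) :
    ‖mainTermsDiff R a₁ a₂ 𝒬 𝒩 γ β‖ ≤
      (1 + Real.log L) ^ 4 * (2 * ((N : ℝ) + 1) / (R : ℝ) ^ 2 + 6 + 4 * Real.log L) *
        ∑ n ∈ 𝒩, ‖β n‖ ^ 2 := by
  -- notation
  set 𝒬' := 𝒬.filter (fun q : ℕ => IsCoprime (q : ℤ) (a₁ * a₂)) with h𝒬'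
  set 𝒩' := 𝒩.filter (fun n : ℕ => IsCoprime (n : ℤ) a₂) with h𝒩'
  set ℓ := 1 + Real.log L with hℓ
  set Λ := 2 * ((N : ℝ) + 1) / (R : ℝ) ^ 2 + 6 + 4 * Real.log L with hΛ
  set S := ∑ n ∈ 𝒩, ‖β n‖ ^ 2 with hS
  have hlogL : 0 ≤ Real.log L := Real.log_natCast_nonneg L
  have hℓ0 : 0 ≤ ℓ := by rw [hℓ]; linarith
  have hΛ0 : 0 ≤ Λ := by rw [hΛ]; positivity
  have hS0 : 0 ≤ S := Finset.sum_nonneg fun _ _ => by positivity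
  have h𝒬'sub : 𝒬' ⊆ Icc 1 L := (Finset.filter_subset _ _).trans h𝒬
  have hq0 : ∀ q ∈ 𝒬', q ≠ 0 := fun q hq => by have := (Finset.mem_Icc.1 (h𝒬'sub hq)).1; omega
  -- the character sums
  set B₁ : (Σ f : ℕ, DirichletCharacter ℂ f) → ℕ → ℂ := fun p q =>
    ∑ n ∈ 𝒩'.filter (fun n => n.Coprime q), β n * (p.2 (n : ZMod p.1))⁻¹ with hB₁
  set B₂ : (Σ f : ℕ, DirichletCharacter ℂ f) → ℕ → ℂ := fun p q =>
    ∑ n ∈ 𝒩'.filter (fun n => n.Coprime q), starRingEnd ℂ (β n) * p.2 (n : ZMod p.1) with hB₂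
  -- Step A: expand the kernel and bound the weights
  have hA : ‖mainTermsDiff R a₁ a₂ 𝒬 𝒩 γ β‖ ≤
      ∑ q₁ ∈ 𝒬', ∑ q₂ ∈ 𝒬', (ℓ ^ 2 * (((q₁ : ℝ)) * q₂)⁻¹) *
        ∑ p ∈ (primIndex (Nat.gcd q₁ q₂)).filter (fun p => R < p.1),
          (‖B₁ p q₂‖ ^ 2 + ‖B₂ p q₁‖ ^ 2) / 2 := by
    unfold mainTermsDiff
    refine (norm_sum_le _ _).trans (Finset.sum_le_sum fun q₁ hq₁ => ?_)
    refine (norm_sum_le _ _).trans (Finset.sum_le_sum fun q₂ hq₂ => ?_)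
    have hq₁1 : 1 ≤ q₁ := Nat.pos_of_ne_zero (hq0 q₁ hq₁)
    have hq₂1 : 1 ≤ q₂ := Nat.pos_of_ne_zero (hq0 q₂ hq₂)
    have hq₁L : q₁ ≤ L := (Finset.mem_Icc.1 (h𝒬'sub hq₁)).2
    haveI : NeZero (Nat.gcd q₁ q₂) := ⟨Nat.gcd_ne_zero_left (hq0 q₁ hq₁)⟩
    rw [norm_mul]
    -- the inner bilinear form
    have hT₁ : ∀ n ∈ 𝒩'.filter (fun n => n.Coprime q₂), n.Coprime (Nat.gcd q₁ q₂) :=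
      fun n hn => Nat.Coprime.coprime_dvd_right (Nat.gcd_dvd_right q₁ q₂) (Finset.mem_filter.1 hn).2
    have hT₂ : ∀ n ∈ 𝒩'.filter (fun n => n.Coprime q₁), n.Coprime (Nat.gcd q₁ q₂) :=
      fun n hn => Nat.Coprime.coprime_dvd_right (Nat.gcd_dvd_left q₁ q₂) (Finset.mem_filter.1 hn).2
    have hinner := norm_sum_sum_mul_uR_le_nat (R : ℝ) (Nat.gcd q₁ q₂)
      (𝒩'.filter (fun n => n.Coprime q₂)) (𝒩'.filter (fun n => n.Coprime q₁))
      β (fun n => starRingEnd ℂ (β n)) hT₁ hT₂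
    have hfilt : (primIndex (Nat.gcd q₁ q₂)).filter (fun p => (R : ℝ) < (p.1 : ℝ)) =
        (primIndex (Nat.gcd q₁ q₂)).filter (fun p => R < p.1) :=
      Finset.filter_congr fun p _ => by exact_mod_cast Iff.rfl
    rw [hfilt] at hinner
    -- the weight
    have hw : ‖(((γ q₁ * γ q₂ / (Nat.lcm q₁ q₂ : ℝ) : ℝ)) : ℂ)‖ ≤ ((Nat.lcm q₁ q₂ : ℝ))⁻¹ := by
      rw [Complex.norm_real, Real.norm_eq_abs, abs_div, abs_mul, Nat.abs_cast, div_eq_mul_inv]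
      have h1 := hγ q₁
      have h2 := hγ q₂
      have h3 : |γ q₁| * |γ q₂| ≤ 1 := by nlinarith [abs_nonneg (γ q₁), abs_nonneg (γ q₂)]
      calc |γ q₁| * |γ q₂| * ((Nat.lcm q₁ q₂ : ℝ))⁻¹ ≤ 1 * ((Nat.lcm q₁ q₂ : ℝ))⁻¹ :=
            mul_le_mul_of_nonneg_right h3 (by positivity)
        _ = _ := one_mul _
    have hwt := inv_lcm_mul_totient_gcd_le hq₁1 hq₁L hq₂1
    calc ‖(((γ q₁ * γ q₂ / (Nat.lcm q₁ q₂ : ℝ) : ℝ)) : ℂ)‖ * _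
        ≤ ((Nat.lcm q₁ q₂ : ℝ))⁻¹ * (((Nat.totient (Nat.gcd q₁ q₂) : ℝ))⁻¹ *
            ∑ p ∈ (primIndex (Nat.gcd q₁ q₂)).filter (fun p => R < p.1),
              ‖B₁ p q₂‖ * ‖B₂ p q₁‖) :=
          mul_le_mul hw hinner (norm_nonneg _) (by positivity)
      _ = ((Nat.lcm q₁ q₂ : ℝ) * (Nat.totient (Nat.gcd q₁ q₂) : ℝ))⁻¹ *
            ∑ p ∈ (primIndex (Nat.gcd q₁ q₂)).filter (fun p => R < p.1),
              ‖B₁ p q₂‖ * ‖B₂ p q₁‖ := by rw [mul_inv, mul_assoc]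
      _ ≤ (ℓ ^ 2 / (((q₁ : ℝ)) * q₂)) *
            ∑ p ∈ (primIndex (Nat.gcd q₁ q₂)).filter (fun p => R < p.1),
              (‖B₁ p q₂‖ ^ 2 + ‖B₂ p q₁‖ ^ 2) / 2 := by
          refine mul_le_mul hwt (Finset.sum_le_sum fun p _ => ?_)
            (Finset.sum_nonneg fun p _ => by positivity) (by positivity)
          have := two_mul_le_add_sq ‖B₁ p q₂‖ ‖B₂ p q₁‖
          linarith
      _ = _ := by rw [div_eq_mul_inv]
  -- Step B: split into the two symmetric pieces
  set D₁ := ∑ q₁ ∈ 𝒬', ∑ q₂ ∈ 𝒬', (((q₁ : ℝ)) * q₂)⁻¹ *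
    ∑ p ∈ (primIndex (Nat.gcd q₁ q₂)).filter (fun p => R < p.1), ‖B₁ p q₂‖ ^ 2 with hD₁
  set D₂ := ∑ q₁ ∈ 𝒬', ∑ q₂ ∈ 𝒬', (((q₁ : ℝ)) * q₂)⁻¹ *
    ∑ p ∈ (primIndex (Nat.gcd q₁ q₂)).filter (fun p => R < p.1), ‖B₂ p q₂‖ ^ 2 with hD₂
  have hB : ∑ q₁ ∈ 𝒬', ∑ q₂ ∈ 𝒬', (ℓ ^ 2 * (((q₁ : ℝ)) * q₂)⁻¹) *
        ∑ p ∈ (primIndex (Nat.gcd q₁ q₂)).filter (fun p => R < p.1),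
          (‖B₁ p q₂‖ ^ 2 + ‖B₂ p q₁‖ ^ 2) / 2 = ℓ ^ 2 / 2 * (D₁ + D₂) := by
    -- the `B₂`-piece with `q₁ ↔ q₂`
    have hswap : ∑ q₁ ∈ 𝒬', ∑ q₂ ∈ 𝒬', (((q₁ : ℝ)) * q₂)⁻¹ *
        ∑ p ∈ (primIndex (Nat.gcd q₁ q₂)).filter (fun p => R < p.1), ‖B₂ p q₁‖ ^ 2 = D₂ := by
      rw [hD₂, Finset.sum_comm]
      refine Finset.sum_congr rfl fun q₁ _ => Finset.sum_congr rfl fun q₂ _ => ?_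
      rw [Nat.gcd_comm]
      congr 1
      ring
    rw [← hswap, hD₁, ← Finset.sum_add_distrib, Finset.mul_sum]
    refine Finset.sum_congr rfl fun q₁ _ => ?_
    rw [← Finset.sum_add_distrib, Finset.mul_sum]
    refine Finset.sum_congr rfl fun q₂ _ => ?_
    rw [← mul_add, ← Finset.sum_add_distrib]
    simp only [Finset.mul_sum]
    refine Finset.sum_congr rfl fun p _ => ?_
    ring
  -- Step C: exchange moduli and characters, then the large sieve, for each piece
  have hC : ∀ (X : (Σ f : ℕ, DirichletCharacter ℂ f) → ℕ → ℂ),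
      (∀ p k, ‖X p (p.1 * k)‖ = ‖X p k‖) →
      (∀ k, ∑ f ∈ Ioc R L, (((f : ℝ)) ^ 2)⁻¹ *
          ∑ ψ ∈ (univ : Finset (DirichletCharacter ℂ f)).filter IsPrimitive, ‖X ⟨f, ψ⟩ k‖ ^ 2 ≤
            Λ * S) →
      ∑ q₁ ∈ 𝒬', ∑ q₂ ∈ 𝒬', (((q₁ : ℝ)) * q₂)⁻¹ *
          ∑ p ∈ (primIndex (Nat.gcd q₁ q₂)).filter (fun p => R < p.1), ‖X p q₂‖ ^ 2 ≤
        ℓ ^ 2 * (Λ * S) := by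
    intro X hXk hLS
    have hswap := sum_sum_inv_mul_sum_primIndex_gcd_le h𝒬'sub R (fun p q => ‖X p q‖ ^ 2)
      (fun p k => ‖X p k‖ ^ 2) (fun p q => by positivity) (fun p k => by positivity)
      (fun p k => by rw [hXk p k])
    refine hswap.trans ?_
    rw [sq, mul_assoc]
    refine mul_le_mul_of_nonneg_left ?_ hℓ0
    calc ∑ k ∈ Icc 1 L, ((k : ℝ))⁻¹ * ∑ f ∈ Ioc R L, (((f : ℝ)) ^ 2)⁻¹ *
            ∑ ψ ∈ (univ : Finset (DirichletCharacter ℂ f)).filter IsPrimitive, ‖X ⟨f, ψ⟩ k‖ ^ 2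
        ≤ ∑ k ∈ Icc 1 L, ((k : ℝ))⁻¹ * (Λ * S) :=
          Finset.sum_le_sum fun k _ => mul_le_mul_of_nonneg_left (hLS k) (by positivity)
      _ = ((harmonic L : ℚ) : ℝ) * (Λ * S) := by
          rw [← Finset.sum_mul, harmonic_eq_sum_Icc]
          push_cast
          rfl
      _ ≤ ℓ * (Λ * S) :=
          mul_le_mul_of_nonneg_right (harmonic_le_one_add_log L) (mul_nonneg hΛ0 hS0)
  -- the two instances
  have hfilter : ∀ k, 𝒩'.filter (fun n => n.Coprime k) =
      𝒩.filter (fun n : ℕ => IsCoprime (n : ℤ) a₂ ∧ n.Coprime k) := fun k =>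
    Finset.filter_filter _ _ _
  have hD₁le : D₁ ≤ ℓ ^ 2 * (Λ * S) := by
    refine hC B₁ (fun p k => ?_) (fun k => ?_)
    · simp only [hB₁, sum_filter_coprime_mul_inv_eq]
    · simp only [hB₁, hfilter]
      exact largeSieve_tail_filter_inv β 𝒩 _ L hR h𝒩
  have hD₂le : D₂ ≤ ℓ ^ 2 * (Λ * S) := by
    refine hC B₂ (fun p k => ?_) (fun k => ?_)
    · simp only [hB₂, sum_filter_coprime_mul_eq]
    · simp only [hB₂, hfilter]
      exact largeSieve_tail_filter_conj β 𝒩 _ L hR h𝒩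
  -- Step D: conclude
  calc ‖mainTermsDiff R a₁ a₂ 𝒬 𝒩 γ β‖ ≤ ℓ ^ 2 / 2 * (D₁ + D₂) := hA.trans_eq hB
    _ ≤ ℓ ^ 2 / 2 * (ℓ ^ 2 * (Λ * S) + ℓ ^ 2 * (Λ * S)) :=
        mul_le_mul_of_nonneg_left (add_le_add hD₁le hD₂le) (by positivity)
    _ = ℓ ^ 4 * Λ * S := by ring

end Drappeau2017

end Literature.NumberTheory.Sieve

end
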